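import Mathlib
import Summits.KontsevichZagierPeriods.Zeta5Search.BigPrimeBelowB0Sharp
import HarnessLib

/-!
# ζ(5) search — (W∞) on the full (WV)-window, part 1: the two-level support (`S' = block β_{j₃}` plus a rim of simple poles)

Cell `pub-zeta5` (HONEST FRAMING: systematic search; no irrationality claim unless certified), typer seat
generation 7.  Second refinement of the partial-fraction bookkeeping behind the big-prime divisibility theorem
(W∞) (`BigPrimePoles` → `BigPrimeSupport` → this file; theorems in `BigPrimeWindow.lean`).  After dropping a slot
`j₁` the poles of `R_b` sit in `block β_{j₂}` (`j₂` minimal among the rest); inside it, the poles OUTSIDE the block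
`S' = block β_{j₃}` of the next parameter (`β_{j₂} ≤ β_{j₃} ≤` the others) form the RIM `block β_{j₂} ∖ S'` and are
SIMPLE.  So the coefficients of order `≥ 2` (in particular those summed in `W` and `U`) live on `S'`, with
denominators built from differences inside `S'` (sixth powers) and from `S'` to the rim (first powers) — all
`< p` as soon as `b₀ + 1 ≤ p + β_{j₂} + β_{j₃}`.  OUR bookkeeping of OUR object; no analytic input.
* `rim`, `num2` (level-2 reduced numerator, five inner blocks), `E2`, `e20`, `z2` (+ `_map`, `E2_coeff_zero`,
  `not_dvd_e20`); `numR_mul_rim_eq`: `numR · ∏_{rim}(X+s) = (∏_{s∉S'}(X+s))^6 · num2`.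
* `pf_eq_zero_of_mem_rim`: on the rim `c_{o,q} = 0` for `o ≥ 1`; **`pf_coeff_eq2`**: `e20(q)^6 · c_{o,q} = z2_{q,5−o}` on `S'`.
-/

noncomputable section

open Finset Polynomial

namespace Summit.KontsevichZagierPeriods.Zeta5Search.BigPrime

open Summit.KontsevichZagierPeriods.Zeta5Search.DualSeries (InBox numPoly)
open Summit.KontsevichZagierPeriods.Zeta5Search.WedgeDictionary (IsPFData coeffW coeffU coeffW_eq coeffU_eq
  exists_isPFData dOf)

/-! ### The level-2 integer model -/

/-- The RIM `block n β₂ ∖ block n β₃` (simple poles of the reduced form). -/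
def rim (n β₂ β₃ : ℕ) : Finset ℕ := block n β₂ \ block n β₃

section Model2

variable (R : Type*) [CommRing R]

/-- Level-2 reduced numerator: `(2X+n) · ∏_{s ∉ B_{j₁}} (X+s) · ∏_{j ∉ {j₁,j₂}} ∏_{s ∈ S' ∖ B_j} (X+s)`, `S' = block β_{j₃}`. -/
def num2 (n : ℕ) (β : ℕ → ℕ) (j₁ j₂ j₃ : ℕ) : R[X] :=
  (C 2 * X + C (n : R)) * (∏ s ∈ range (n + 1) \ block n (β j₁), (X + C (s : R))) *
    ∏ j ∈ ((range 7).erase j₁).erase j₂, ∏ s ∈ block n (β j₃) \ block n (β j), (X + C (s : R))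

/-- Level-2 recentred denominator: `∏_{s ∈ S'∖q}(X + s − q)^6 · ∏_{s ∈ rim}(X + s − q)`. -/
def E2 (n : ℕ) (β : ℕ → ℕ) (j₂ j₃ q : ℕ) : R[X] :=
  (∏ s ∈ (block n (β j₃)).erase q, (X + C ((s : R) - q)) ^ 6) *
    ∏ s ∈ rim n (β j₂) (β j₃), (X + C ((s : R) - q))

end Model2

/-- Constant coefficient of `E2` over `ℤ`. -/
def e20 (n : ℕ) (β : ℕ → ℕ) (j₂ j₃ q : ℕ) : ℤ :=
  (∏ s ∈ (block n (β j₃)).erase q, ((s : ℤ) - q) ^ 6) * ∏ s ∈ rim n (β j₂) (β j₃), ((s : ℤ) - q)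

/-- The level-2 integers `z2_{q,i}`. -/
def z2 (n : ℕ) (β : ℕ → ℕ) (j₁ j₂ j₃ q i : ℕ) : ℤ :=
  (taylor (-(q : ℤ)) (num2 ℤ n β j₁ j₂ j₃) * truncInv (E2 ℤ n β j₂ j₃ q) 6).coeff i

/-- `num2` is compatible with ring maps. -/
theorem num2_map {R T : Type*} [CommRing R] [CommRing T] (φ : R →+* T) (n : ℕ) (β : ℕ → ℕ) (j₁ j₂ j₃ : ℕ) :
    (num2 R n β j₁ j₂ j₃).map φ = num2 T n β j₁ j₂ j₃ := by
  simp only [num2, Polynomial.map_mul, Polynomial.map_add, Polynomial.map_prod, map_C, map_X]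
  simp only [map_natCast, map_ofNat]

/-- `E2` is compatible with ring maps. -/
theorem E2_map {R T : Type*} [CommRing R] [CommRing T] (φ : R →+* T) (n : ℕ) (β : ℕ → ℕ) (j₂ j₃ q : ℕ) :
    (E2 R n β j₂ j₃ q).map φ = E2 T n β j₂ j₃ q := by
  simp only [E2, Polynomial.map_mul, Polynomial.map_prod, Polynomial.map_pow, Polynomial.map_add, map_C, map_X]
  simp only [map_sub, map_natCast]

/-- Constant coefficient of `E2` over `ℤ` is `e20`. -/
theorem E2_coeff_zero (n : ℕ) (β : ℕ → ℕ) (j₂ j₃ q : ℕ) : (E2 ℤ n β j₂ j₃ q).coeff 0 = e20 n β j₂ j₃ q := by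
  rw [E2, e20, coeff_zero_eq_eval_zero, eval_mul, eval_prod, eval_prod]
  congr 1
  · refine prod_congr rfl fun s _ => ?_
    rw [eval_pow, eval_add, eval_X, eval_C, zero_add]
  · refine prod_congr rfl fun s _ => ?_
    rw [eval_add, eval_X, eval_C, zero_add]

/-- No prime with `n + 1 ≤ p + β₂ + β₃` divides `e20(q)` for `q ∈ S'` (`β₂ ≤ β₃`, `2β₃ ≤ n`). -/
theorem not_dvd_e20 {p : ℕ} (hp : p.Prime) {n : ℕ} {β : ℕ → ℕ} {j₂ j₃ : ℕ} (hT : n + 1 ≤ p + β j₂ + β j₃)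
    (h23 : β j₂ ≤ β j₃) {q : ℕ} (hq : q ∈ block n (β j₃)) : ¬ (p : ℤ) ∣ e20 n β j₂ j₃ q := by
  have hpZ : Prime (p : ℤ) := Nat.prime_iff_prime_int.1 hp
  rw [block, mem_Icc] at hq
  rw [e20]
  intro h
  rcases hpZ.dvd_or_dvd h with h1 | h1
  · obtain ⟨s, hs, hdvd⟩ := (hpZ.dvd_finsetProd_iff _).1 h1
    have hsq : s ≠ q ∧ s ∈ block n (β j₃) := by simpa [mem_erase] using hs
    have hs' := hsq.2
    rw [block, mem_Icc] at hs'
    have h2 : (p : ℤ) ∣ (s : ℤ) - q := hpZ.dvd_of_dvd_pow hdvd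
    have h3 : ((s : ℤ) - q) = 0 := by
      refine Int.eq_zero_of_dvd_of_natAbs_lt_natAbs h2 ?_
      simp only [Int.natAbs_natCast]; omega
    omega
  · obtain ⟨s, hs, hdvd⟩ := (hpZ.dvd_finsetProd_iff _).1 h1
    rw [rim, mem_sdiff, block, block, mem_Icc, mem_Icc] at hs
    have h3 : ((s : ℤ) - q) = 0 := by
      refine Int.eq_zero_of_dvd_of_natAbs_lt_natAbs hdvd ?_
      simp only [Int.natAbs_natCast]; omega
    omega

/-! ### Factorisation of the block-form numerator at level 2 -/

/-- `numR · ∏_{s ∈ rim}(X+s) = (∏_{s ∉ S'}(X+s))^6 · num2`. -/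
theorem numR_mul_rim_eq (R : Type*) [CommRing R] (n : ℕ) (β : ℕ → ℕ) {j₁ j₂ j₃ : ℕ} (hj₁ : j₁ ∈ range 7)
    (hj₂ : j₂ ∈ (range 7).erase j₁) (h23 : β j₂ ≤ β j₃)
    (hmin : ∀ j ∈ ((range 7).erase j₁).erase j₂, β j₃ ≤ β j) :
    numR R n β * ∏ s ∈ rim n (β j₂) (β j₃), (X + C (s : R)) =
      (∏ s ∈ range (n + 1) \ block n (β j₃), (X + C (s : R))) ^ 6 * num2 R n β j₁ j₂ j₃ := by
  have hS : block n (β j₃) ⊆ range (n + 1) := block_subset n (β j₃)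
  have h32 : block n (β j₃) ⊆ block n (β j₂) := block_mono h23
  -- the five inner slots
  have hsplit : ∀ j ∈ ((range 7).erase j₁).erase j₂,
      ∏ s ∈ range (n + 1) \ block n (β j), (X + C (s : R)) =
        (∏ s ∈ range (n + 1) \ block n (β j₃), (X + C (s : R))) *
          ∏ s ∈ block n (β j₃) \ block n (β j), (X + C (s : R)) := by
    intro j hj
    have hsub : block n (β j) ⊆ block n (β j₃) := block_mono (hmin j hj)
    have hunion : range (n + 1) \ block n (β j) =
        (range (n + 1) \ block n (β j₃)) ∪ (block n (β j₃) \ block n (β j)) := by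
      ext s
      simp only [mem_sdiff, mem_union]
      constructor
      · intro ⟨h1, h2⟩
        by_cases h3 : s ∈ block n (β j₃)
        · exact Or.inr ⟨h3, h2⟩
        · exact Or.inl ⟨h1, h3⟩
      · rintro (⟨h1, h2⟩ | ⟨h1, h2⟩)
        · exact ⟨h1, fun h => h2 (hsub h)⟩
        · exact ⟨hS h1, h2⟩
    have hdisj : Disjoint (range (n + 1) \ block n (β j₃)) (block n (β j₃) \ block n (β j)) := by
      rw [Finset.disjoint_left]
      intro s hs hs'
      exact (mem_sdiff.1 hs).2 (mem_sdiff.1 hs').1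
    rw [hunion, prod_union hdisj]
  -- the rim slot: (range \ B_{j₂}) ∪ rim = range \ S'
  have hrim : (∏ s ∈ range (n + 1) \ block n (β j₂), (X + C (s : R))) * ∏ s ∈ rim n (β j₂) (β j₃), (X + C (s : R)) =
      ∏ s ∈ range (n + 1) \ block n (β j₃), (X + C (s : R)) := by
    have hunion : range (n + 1) \ block n (β j₃) = (range (n + 1) \ block n (β j₂)) ∪ rim n (β j₂) (β j₃) := by
      ext s
      simp only [rim, mem_sdiff, mem_union]
      constructor
      · intro ⟨h1, h2⟩
        by_cases h3 : s ∈ block n (β j₂)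
        · exact Or.inr ⟨h3, h2⟩
        · exact Or.inl ⟨h1, h3⟩
      · rintro (⟨h1, h2⟩ | ⟨h1, h2⟩)
        · exact ⟨h1, fun h => h2 (h32 h)⟩
        · exact ⟨block_subset n (β j₂) h1, h2⟩
    have hdisj : Disjoint (range (n + 1) \ block n (β j₂)) (rim n (β j₂) (β j₃)) := by
      rw [Finset.disjoint_left]
      intro s hs hs'
      exact (mem_sdiff.1 hs).2 (mem_sdiff.1 (by simpa [rim] using hs')).1
    rw [hunion, prod_union hdisj]
  rw [numR, num2, ← mul_prod_erase (range 7) _ hj₁, ← mul_prod_erase ((range 7).erase j₁) _ hj₂,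
    prod_congr rfl hsplit, prod_mul_distrib, prod_const, card_erase_of_mem hj₂, card_erase_of_mem hj₁, card_range]
  rw [show (7 - 1 - 1 : ℕ) = 5 by norm_num]
  have key := hrim
  -- abbreviate
  set A := ∏ s ∈ range (n + 1) \ block n (β j₃), (X + C (s : R)) with hA
  set Bq := ∏ s ∈ range (n + 1) \ block n (β j₂), (X + C (s : R)) with hBq
  set Rm := ∏ s ∈ rim n (β j₂) (β j₃), (X + C (s : R)) with hRm
  set L := (C 2 * X + C (n : R)) with hL
  set P1 := ∏ s ∈ range (n + 1) \ block n (β j₁), (X + C (s : R)) with hP1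
  set Inner := ∏ j ∈ ((range 7).erase j₁).erase j₂, ∏ s ∈ block n (β j₃) \ block n (β j), (X + C (s : R)) with hI
  calc L * (P1 * (Bq * (A ^ 5 * Inner))) * Rm = L * P1 * (Bq * Rm) * (A ^ 5 * Inner) := by ring
    _ = L * P1 * A * (A ^ 5 * Inner) := by rw [key]
    _ = A ^ 6 * (L * P1 * Inner) := by ring

/-! ### Level-2 Taylor identity over ℚ -/

/-- On the rim the poles are SIMPLE: `c_{o,q} = 0` for `1 ≤ o < 6`. -/
theorem pf_eq_zero_of_mem_rim (b : ℕ → ℤ) (hb : InBox b) (hhalf : ∀ j ∈ range 7, 2 * b (j + 1) ≤ b 0 + 1)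
    {c : ℕ → ℕ → ℚ} (hc : IsPFData b c) {j₁ j₂ j₃ : ℕ} (hj₁ : j₁ ∈ range 7) (hj₂ : j₂ ∈ (range 7).erase j₁)
    (h23 : (b (j₂ + 1)).toNat ≤ (b (j₃ + 1)).toNat)
    (hmin : ∀ j ∈ ((range 7).erase j₁).erase j₂, (b (j₃ + 1)).toNat ≤ (b (j + 1)).toNat)
    {q : ℕ} (hq : q ∈ rim (b 0).toNat (b (j₂ + 1)).toNat (b (j₃ + 1)).toNat) {o : ℕ} (ho1 : 1 ≤ o) (ho : o < 6) :
    c o q = 0 := by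
  set n := (b 0).toNat with hn
  set β : ℕ → ℕ := fun j => (b (j + 1)).toNat with hβ
  have hq' : q ∈ range (n + 1) \ block n (β j₃) := by
    have := hq; rw [rim, mem_sdiff] at this
    exact mem_sdiff.2 ⟨block_subset n (β j₂) this.1, this.2⟩
  have hqn : q ≤ n := by have := mem_range.1 (mem_sdiff.1 hq').1; omega
  have h1 := taylor_numPoly_congr b hc hqn
  rw [numPoly_eq_numR b hb hhalf] at h1
  have hfac := congrArg (taylor (-(q : ℚ))) (numR_mul_rim_eq ℚ n β hj₁ hj₂ h23 hmin)
  rw [taylor_mul, taylor_mul, taylor_pow, taylor_prod', taylor_prod'] at hfac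
  -- X^6 divides the outside product (it contains s = q)
  have hX6 : (X : ℚ[X]) ^ 6 ∣ (∏ s ∈ range (n + 1) \ block n (β j₃), taylor (-(q : ℚ)) (X + C (s : ℚ))) ^ 6 := by
    refine pow_dvd_pow_of_dvd ?_ 6
    have hf : taylor (-(q : ℚ)) (X + C (q : ℚ)) = X := by rw [taylor_X_add_C, add_neg_cancel, C_0, add_zero]
    exact (dvd_of_eq hf.symm).trans
      (Finset.dvd_prod_of_mem (fun s : ℕ => taylor (-(q : ℚ)) (X + C (s : ℚ))) hq')
  -- the rim product splits off the factor X at s = q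
  have hRim : ∏ s ∈ rim n (β j₂) (β j₃), taylor (-(q : ℚ)) (X + C (s : ℚ)) =
      X * ∏ s ∈ (rim n (β j₂) (β j₃)).erase q, (X + C ((s : ℚ) - q)) := by
    rw [← mul_prod_erase _ _ hq]
    congr 1
    · rw [taylor_X_add_C, add_neg_cancel, C_0, add_zero]
    · exact prod_congr rfl fun s _ => by rw [taylor_X_add_C, sub_eq_add_neg]
  rw [hRim] at hfac
  -- X^5 ∣ numR(X − q)
  have hRim0 : (∏ s ∈ (rim n (β j₂) (β j₃)).erase q, (X + C ((s : ℚ) - q))).coeff 0 ≠ 0 := by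
    rw [coeff_zero_eq_eval_zero, eval_prod]
    refine prod_ne_zero_iff.2 fun s hs => ?_
    rw [eval_add, eval_X, eval_C, zero_add]
    have : s ≠ q := (mem_erase.1 hs).1
    have : (s : ℚ) ≠ q := by exact_mod_cast this
    exact sub_ne_zero.2 this
  have h5 : (X : ℚ[X]) ^ 5 ∣ taylor (-(q : ℚ)) (numR ℚ n β) := by
    have h6 : (X : ℚ[X]) ^ 6 ∣ taylor (-(q : ℚ)) (numR ℚ n β) *
        (X * ∏ s ∈ (rim n (β j₂) (β j₃)).erase q, (X + C ((s : ℚ) - q))) := by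
      rw [hfac]; exact hX6.mul_right _
    have h6' : (X : ℚ[X]) ^ 5 * X ∣ (taylor (-(q : ℚ)) (numR ℚ n β) *
        ∏ s ∈ (rim n (β j₂) (β j₃)).erase q, (X + C ((s : ℚ) - q))) * X := by
      rw [← pow_succ]; convert h6 using 1; ring
    have h5' := (mul_dvd_mul_iff_right X_ne_zero).1 h6'
    rw [mul_comm] at h5'
    exact X_pow_dvd_of_mul_left hRim0 h5'
  -- hence X^5 ∣ S_q · ER and X^5 ∣ S_q
  have h2 : (X : ℚ[X]) ^ 5 ∣ ER ℚ n q * (∑ o ∈ range 6, C (c o q) * X ^ (5 - o)) := by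
    have h1' : (X : ℚ[X]) ^ 5 ∣ taylor (-(q : ℚ)) (numR ℚ n β) -
        (∑ o ∈ range 6, C (c o q) * X ^ (5 - o)) * ER ℚ n q := (pow_dvd_pow X (by norm_num)).trans h1
    have := dvd_sub h5 h1'
    rw [sub_sub_cancel, mul_comm] at this
    exact this
  have hE : (ER ℚ n q).coeff 0 ≠ 0 := by
    rw [← ER_map (Int.castRingHom ℚ), coeff_map, ER_coeff_zero]
    simpa using e0Z_ne_zero n q
  have h3 : (X : ℚ[X]) ^ 5 ∣ ∑ o ∈ range 6, C (c o q) * X ^ (5 - o) := X_pow_dvd_of_mul_left hE h2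
  have hcoef := (X_pow_dvd_iff.1 h3) (5 - o) (by omega)
  rw [finsetSum_coeff, sum_eq_single o] at hcoef
  · simpa [coeff_C_mul, coeff_X_pow] using hcoef
  · intro o' ho' hne
    have hne' : 5 - o ≠ 5 - o' := by have := mem_range.1 ho'; omega
    simp [coeff_C_mul, coeff_X_pow, hne']
  · intro h'; exact absurd (mem_range.2 ho) h'

/-- **Level-2 Taylor identity**: for `q ∈ S'`, `e20(q)^6 · c_{o,q} = z2_{q,5−o}`. -/
theorem pf_coeff_eq2 (b : ℕ → ℤ) (hb : InBox b) (hhalf : ∀ j ∈ range 7, 2 * b (j + 1) ≤ b 0 + 1)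
    {c : ℕ → ℕ → ℚ} (hc : IsPFData b c) {j₁ j₂ j₃ : ℕ} (hj₁ : j₁ ∈ range 7) (hj₂ : j₂ ∈ (range 7).erase j₁)
    (h23 : (b (j₂ + 1)).toNat ≤ (b (j₃ + 1)).toNat)
    (hmin : ∀ j ∈ ((range 7).erase j₁).erase j₂, (b (j₃ + 1)).toNat ≤ (b (j + 1)).toNat)
    {q : ℕ} (hqS : q ∈ block (b 0).toNat (b (j₃ + 1)).toNat) {o : ℕ} (ho : o < 6) :
    ((e20 (b 0).toNat (fun j => (b (j + 1)).toNat) j₂ j₃ q : ℤ) : ℚ) ^ 6 * c o q =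
      (z2 (b 0).toNat (fun j => (b (j + 1)).toNat) j₁ j₂ j₃ q (5 - o) : ℚ) := by
  set n := (b 0).toNat with hn
  set β : ℕ → ℕ := fun j => (b (j + 1)).toNat with hβ
  have hq : q ≤ n := by have := block_subset n (β j₃) hqS; rw [mem_range] at this; omega
  set Sq : ℚ[X] := ∑ o ∈ range 6, C (c o q) * X ^ (5 - o) with hSq
  set Out : ℚ[X] := (∏ s ∈ range (n + 1) \ block n (β j₃), taylor (-(q : ℚ)) (X + C (s : ℚ))) ^ 6 with hOut
  set Rim : ℚ[X] := ∏ s ∈ rim n (β j₂) (β j₃), (X + C ((s : ℚ) - q)) with hRimdef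
  have h1 := taylor_numPoly_congr b hc hq
  rw [numPoly_eq_numR b hb hhalf] at h1
  have hfac := congrArg (taylor (-(q : ℚ))) (numR_mul_rim_eq ℚ n β hj₁ hj₂ h23 hmin)
  rw [taylor_mul, taylor_mul, taylor_pow, taylor_prod', taylor_prod'] at hfac
  have hRim : ∏ s ∈ rim n (β j₂) (β j₃), taylor (-(q : ℚ)) (X + C (s : ℚ)) = Rim :=
    prod_congr rfl fun s _ => by rw [taylor_X_add_C, sub_eq_add_neg]
  rw [hRim] at hfac
  -- split ER along S'
  have hER : ER ℚ n q = Out * ∏ s ∈ (block n (β j₃)).erase q, (X + C ((s : ℚ) - q)) ^ 6 := by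
    have hsplit : (range (n + 1)).erase q = (range (n + 1) \ block n (β j₃)) ∪ (block n (β j₃)).erase q := by
      ext s
      simp only [mem_erase, mem_sdiff, mem_union]
      constructor
      · intro ⟨h1, h2⟩
        by_cases h3 : s ∈ block n (β j₃)
        · exact Or.inr ⟨h1, h3⟩
        · exact Or.inl ⟨h2, h3⟩
      · rintro (⟨h1, h2⟩ | ⟨h1, h2⟩)
        · exact ⟨fun h => h2 (h ▸ hqS), h1⟩
        · exact ⟨h1, block_subset n (β j₃) h2⟩
    have hdisj : Disjoint (range (n + 1) \ block n (β j₃)) ((block n (β j₃)).erase q) := by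
      rw [Finset.disjoint_left]
      intro s hs hs'
      exact (mem_sdiff.1 hs).2 (mem_erase.1 hs').2
    have hOut' : Out = ∏ s ∈ range (n + 1) \ block n (β j₃), (X + C ((s : ℚ) - q)) ^ 6 := by
      rw [hOut, ← prod_pow]
      exact prod_congr rfl fun s _ => by rw [taylor_X_add_C, sub_eq_add_neg]
    rw [ER, hsplit, prod_union hdisj, hOut']
  -- Out · (num2(X−q) − Sq·E2) is divisible by X^6
  have hE2 : E2 ℚ n β j₂ j₃ q = (∏ s ∈ (block n (β j₃)).erase q, (X + C ((s : ℚ) - q)) ^ 6) * Rim := by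
    rw [E2]
  have h2 : (X : ℚ[X]) ^ 6 ∣ Out * (taylor (-(q : ℚ)) (num2 ℚ n β j₁ j₂ j₃) - Sq * E2 ℚ n β j₂ j₃ q) := by
    have h1' : (X : ℚ[X]) ^ 6 ∣ (taylor (-(q : ℚ)) (numR ℚ n β) - Sq * ER ℚ n q) * Rim := h1.mul_right _
    have : (taylor (-(q : ℚ)) (numR ℚ n β) - Sq * ER ℚ n q) * Rim =
        Out * (taylor (-(q : ℚ)) (num2 ℚ n β j₁ j₂ j₃) - Sq * E2 ℚ n β j₂ j₃ q) := by
      rw [sub_mul, hfac, hER, hE2]; ring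
    rwa [this] at h1'
  have hOut0 : Out.coeff 0 ≠ 0 := by
    rw [hOut, coeff_zero_eq_eval_zero, eval_pow, eval_prod]
    refine pow_ne_zero _ (prod_ne_zero_iff.2 fun s hs => ?_)
    rw [taylor_X_add_C, eval_add, eval_X, eval_C, zero_add]
    have hsq : s ≠ q := fun h => (mem_sdiff.1 hs).2 (h ▸ hqS)
    have : (s : ℚ) - q ≠ 0 := sub_ne_zero.2 (by exact_mod_cast hsq)
    rwa [← sub_eq_add_neg]
  have h3 : (X : ℚ[X]) ^ 6 ∣ taylor (-(q : ℚ)) (num2 ℚ n β j₁ j₂ j₃) - Sq * E2 ℚ n β j₂ j₃ q :=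
    X_pow_dvd_of_mul_left hOut0 h2
  -- truncated inverse
  set J : ℚ[X] := truncInv (E2 ℚ n β j₂ j₃ q) 6 with hJ
  have h4 := truncInv_spec (E2 ℚ n β j₂ j₃ q) 6
  have he0 : (E2 ℚ n β j₂ j₃ q).coeff 0 = (e20 n β j₂ j₃ q : ℚ) := by
    rw [← E2_map (Int.castRingHom ℚ), coeff_map, E2_coeff_zero]; simp
  have h5 : (X : ℚ[X]) ^ 6 ∣ taylor (-(q : ℚ)) (num2 ℚ n β j₁ j₂ j₃) * J - Sq * C ((e20 n β j₂ j₃ q : ℚ) ^ 6) := by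
    have : taylor (-(q : ℚ)) (num2 ℚ n β j₁ j₂ j₃) * J - Sq * C ((e20 n β j₂ j₃ q : ℚ) ^ 6) =
        (taylor (-(q : ℚ)) (num2 ℚ n β j₁ j₂ j₃) - Sq * E2 ℚ n β j₂ j₃ q) * J +
          Sq * (E2 ℚ n β j₂ j₃ q * J - C ((E2 ℚ n β j₂ j₃ q).coeff 0 ^ 6)) := by
      rw [he0]; ring
    rw [this]
    exact dvd_add (h3.mul_right J) (h4.mul_left Sq)
  have h6 := coeff_eq_of_X_pow_dvd_sub h5 (show 5 - o < 6 by omega)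
  have hL : taylor (-(q : ℚ)) (num2 ℚ n β j₁ j₂ j₃) * J =
      (taylor (-(q : ℤ)) (num2 ℤ n β j₁ j₂ j₃) * truncInv (E2 ℤ n β j₂ j₃ q) 6).map (Int.castRingHom ℚ) := by
    rw [Polynomial.map_mul, map_taylor, num2_map, truncInv_map, E2_map]
    simp [hJ]
  have hR : (Sq * C ((e20 n β j₂ j₃ q : ℚ) ^ 6)).coeff (5 - o) = ((e20 n β j₂ j₃ q : ℤ) : ℚ) ^ 6 * c o q := by
    rw [hSq, sum_mul, finsetSum_coeff, sum_eq_single o]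
    · simp only [coeff_mul_C, coeff_C_mul, coeff_X_pow, if_true]; ring
    · intro o' ho' hne
      have hne' : 5 - o ≠ 5 - o' := by have := mem_range.1 ho'; omega
      simp only [coeff_mul_C, coeff_C_mul, coeff_X_pow, if_neg hne']; ring
    · intro h; exact absurd (mem_range.2 ho) h
  rw [hL, coeff_map, hR] at h6
  rw [← h6, z2]
  simp

end Summit.KontsevichZagierPeriods.Zeta5Search.BigPrime

end
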